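import Summits.AnomalousDissipation.AnomalousDissipation.Cruxes.GalerkinFloor.Lines.birth
import Summits.AnomalousDissipation.AnomalousDissipation.Theorems.MomentParityResolvedDissipationOfNoMeanLeakage
import Summits.AnomalousDissipation.AnomalousDissipation.Theorems.WindLineWindLineReachesCalmEnergy
import Literature.Analysis.FluidPDE.SteadyGalerkinApprox
import Literature.Analysis.FluidPDE.LongTimeAverageSubadditive

/-!
# Stub-critic scratch — typed helper signatures of `STUB-PLAN-stub_fixedViscosityResolution.md`
# (crux stmt-AnomalousDissipation-1582 `DecimationAxis.GalerkinFloor`, skeleton `Lines/birth.lean`)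

Seat `scrit-stmt-AnomalousDissipation-1582-stub_fixedVisc`.  Nothing here is registered.  `sorry` marks the
helpers of the merged plan (Phase 0 sectors/bookkeeping, Phase R forcing-band floor, Phase 2T shell + the ONE
sub-stub to register); the k = 2 dictionary / Krylov–Bogoliubov helpers A0–A3, B1–B4, C.1–C.2 live in
`STUB_IDEAS_stub_fixedViscosityResolution_2.lean` (crux dir; not a built module, so its C1 is restated as a placeholder).
Real compositions (sorry-free modulo the sorried helpers they name): `stub_of_noMeanLeakage` (C5),
`fixedViscosityResolution_floorSector` (R3b ⇐ R2).
-/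

set_option linter.dupNamespace false
set_option linter.unusedVariables false

noncomputable section

open MeasureTheory Filter Topology Set
open scoped ENNReal
open Literature.Analysis.FunctionSpaces Literature.Analysis.FunctionSpaces.Torus Literature.Analysis.FluidPDE
open Summit.AnomalousDissipation.AnomalousDissipation.Cruxes.GalerkinFloor.Birth

namespace Summit.AnomalousDissipation.AnomalousDissipation.Cruxes.GalerkinFloor.StubPlan

/-- Frequency lattice `ℤ³`. -/
local notation "ℤ³" => Fin 3 → ℤ
/-- Complex coefficient vectors `ℂ³`. -/
local notation "ℂ³" => EuclideanSpace ℂ (Fin 3)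

/-- k = 2's **C1** (`STUB_IDEAS_stub_fixedViscosityResolution_2.lean`, a real composition over its sorried A0–A3 there;
restated here as a placeholder because that scratch module is not built on the farm). -/
theorem stub_of_resolvedDissipation (h : Theses.MomentParity.ResolvedDissipation) :
    Statement.stub_fixedViscosityResolution := by
  sorry

/-! ## Phase 0 — sectors and coordinate bookkeeping (S each) -/

section P0
variable {ν : ℝ} {N K : ℕ} {g : ℤ³ → ℂ³} {S : Finset ℤ³} {c : ℝ → ↥S → ℂ³}

/-- Power injection `W(t) = Σ_{k∈S} Re⟪g_k, c_k(t)⟫` (the work row of the coordinate energy identity). -/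
def coeffPower (g : ℤ³ → ℂ³) (c : ℝ → ↥S → ℂ³) : ℝ → ℝ :=
  fun t => ∑ k : ↥S, (inner ℂ (g k) (c t k)).re

/-- Forcing size `G² = Σ_{k ∈ freqBall N} ‖g_k‖²` (`= ‖f_g‖₂²`, A0.4). -/
def forceSq (N : ℕ) (g : ℤ³ → ℂ³) : ℝ :=
  ∑ k ∈ freqBall N, ‖g k‖ ^ 2

/-- P0.1 The crux's solution notion IS the tree's `IsGalerkinODESolution` from the datum `c 0` with the constant
force coefficients `g↾S` (structures match field for field). -/
theorem isCoeffTrajectory_iff :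
    IsCoeffTrajectory S ν g c ↔ IsGalerkinODESolution ν (fun k : ↥S => g k) (c 0) c := by
  sorry

/-- P0.2 A designer force restricts to a REAL coefficient vector on any `S` (`IsConjSymm g`). -/
theorem isRealCoeff_restrict (hg : IsDesignerForce N g) : IsRealCoeff (fun k : ↥S => g k) := by
  sorry

/-- P0.3 **Coordinate energy identity** along a trajectory on the punctured ball (`hasDerivWithinAt_sum_norm_sq` +
`sum_re_inner_galerkinRHS_eq` + FTC as in `galerkin_energy_identity`; symmetry `neg_mem_freqBall_erase_zero`). -/
theorem coeffEnergy_sub_eq (hg : IsDesignerForce N g) (hS : S = (freqBall K).erase 0)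
    (hc : IsCoeffTrajectory S ν g c) {T : ℝ} (hT : 0 ≤ T) :
    coeffEnergy c T - coeffEnergy c 0 = 2 * ∫ t in (0 : ℝ)..T, (coeffPower g c t - coeffDissipation ν c t) := by
  sorry

/-- P0.4 **Uniform energy bound** (port of `energy_le_of_isGalerkinODESolution`: `ψ' ≤ 2(G√ψ − 4π²νψ)`,
`|k|² ≥ 1` on the punctured ball). -/
theorem coeffEnergy_le_max (hν : 0 < ν) (hg : IsDesignerForce N g) (hS : S = (freqBall K).erase 0)
    (hc : IsCoeffTrajectory S ν g c) {t : ℝ} (ht : 0 ≤ t) :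
    coeffEnergy c t ≤ max (coeffEnergy c 0) (forceSq N g / (4 * Real.pi ^ 2 * ν) ^ 2) := by
  sorry

/-- P0.5 Time-averaged energy identity: `⟨D⟩_T ≤ ⟨W⟩_T + En(0)/(2T)`. -/
theorem timeMean_coeffDissipation_le (hg : IsDesignerForce N g) (hS : S = (freqBall K).erase 0)
    (hc : IsCoeffTrajectory S ν g c) {T : ℝ} (hT : 0 < T) :
    timeMean (coeffDissipation ν c) T ≤ timeMean (coeffPower g c) T + coeffEnergy c 0 / (2 * T) := by
  sorry

/-- P0.6 Boundedness of the running means (no junk `liminf`/`limsup`): all three functionals are continuous on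
`[0,∞)`, nonnegative and bounded by `ν·4π²K²·sup En` resp. `sup En`. -/
theorem isBoundedUnder_timeMeans (hν : 0 < ν) (hg : IsDesignerForce N g) (hS : S = (freqBall K).erase 0)
    (hc : IsCoeffTrajectory S ν g c) (M : ℕ) :
    IsBoundedUnder (· ≤ ·) atTop (timeMean (coeffEnergy c)) ∧
      IsBoundedUnder (· ≤ ·) atTop (timeMean (coeffDissipation ν c)) ∧
      IsBoundedUnder (· ≥ ·) atTop (timeMean (coeffDissipation ν c)) ∧
      IsBoundedUnder (· ≤ ·) atTop (timeMean (coeffResolvedDissipation ν M c)) ∧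
      IsBoundedUnder (· ≥ ·) atTop (timeMean (coeffResolvedDissipation ν M c)) := by
  sorry

/-- P0.7 Trivial sector `ε ≤ δ` (covers `ε ≤ 0`): resolved dissipation is nonnegative with bounded means. -/
theorem sector_eps_le_delta (hν : 0 < ν) (hg : IsDesignerForce N g) (hS : S = (freqBall K).erase 0)
    (hc : IsCoeffTrajectory S ν g c) {ε δ : ℝ} (hεδ : ε ≤ δ) (M : ℕ) :
    ε - δ ≤ longTimeAvgInf (coeffResolvedDissipation ν M c) := by
  sorry

end P0

/-! ## Phase R — the FORCING-BAND FLOOR (M; the cheapest landable theorem of the crux directory) -/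

section R
variable {ν : ℝ} {N K : ℕ} {g : ℤ³ → ℂ³} {S : Finset ℤ³} {c : ℝ → ↥S → ℂ³}

/-- R1 Pointwise: the force only works on the band `|k| ≤ N`, where `‖c_k‖² ≤ |k|²‖c_k‖²` (`k ≠ 0`), so by
Cauchy–Schwarz and AM–GM, for every `ε > 0`: `W ≤ ε/2 + G²·D_N/(8π²νε)` with `D_N = coeffResolvedDissipation ν N`. -/
theorem coeffPower_le (hν : 0 < ν) (hg : IsDesignerForce N g) (hS : S = (freqBall K).erase 0)
    (hcm : ∀ t, c t ∈ galerkinSubspace S) {ε : ℝ} (hε : 0 < ε) (t : ℝ) :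
    coeffPower g c t ≤ ε / 2 + forceSq N g * coeffResolvedDissipation ν N c t / (8 * Real.pi ^ 2 * ν * ε) := by
  sorry

/-- R2 **Forcing-band floor.** Along EVERY trajectory with `liminf`-mean total dissipation `≥ ε > 0`,
`G² · ⟨D_N⟩⁻ ≥ 4π²νε²` (energy identity P0.5 + R1 + `liminf` algebra; `G = 0` makes the hypotheses absurd).
No energy hypothesis, uniform in `K` and in the datum. -/
theorem forcingBand_floor (hν : 0 < ν) (hg : IsDesignerForce N g) (hS : S = (freqBall K).erase 0)
    (hc : IsCoeffTrajectory S ν g c) {ε : ℝ} (hε : 0 < ε) (hD : ε ≤ longTimeAvgInf (coeffDissipation ν c)) :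
    4 * Real.pi ^ 2 * ν * ε ^ 2 ≤ forceSq N g * longTimeAvgInf (coeffResolvedDissipation ν N c) := by
  sorry

/-- R3a **Fixed-viscosity resolved FRACTION, quantitatively** (the `Lines/fraction.lean` §4 target
`ResolvedFractionAtFixedViscosity`, over the character-identical vocabulary): `η := 4π²νε²/G²`, `M := N`. -/
theorem resolvedFraction_fixedViscosity :
    ∀ ν : ℝ, 0 < ν → ∀ (N : ℕ) (g : ℤ³ → ℂ³), IsDesignerForce N g → ∀ (E ε : ℝ), 0 < ε →
      ∃ η : ℝ, 0 < η ∧ ∃ M : ℕ, ∀ (K : ℕ) (S : Finset ℤ³), S = (freqBall K).erase 0 →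
        ∀ c : ℝ → ↥S → ℂ³, IsCoeffTrajectory S ν g c →
          longTimeAvgSup (coeffEnergy c) ≤ E → ε ≤ longTimeAvgInf (coeffDissipation ν c) →
            η ≤ longTimeAvgInf (coeffResolvedDissipation ν M c) := by
  sorry

/-- R3b **Stub-at in the floor sector** `ε − δ ≤ 4π²νε²/G²` with `M := N` (real composition over R2). -/
theorem fixedViscosityResolution_floorSector {ν : ℝ} (hν : 0 < ν) {N : ℕ} {g : ℤ³ → ℂ³}
    (hg : IsDesignerForce N g) (hG : 0 < forceSq N g) {ε δ : ℝ} (hε : 0 < ε)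
    (hsec : ε - δ ≤ 4 * Real.pi ^ 2 * ν * ε ^ 2 / forceSq N g)
    (K : ℕ) (S : Finset ℤ³) (hS : S = (freqBall K).erase 0) (c : ℝ → ↥S → ℂ³) (hc : IsCoeffTrajectory S ν g c)
    (hD : ε ≤ longTimeAvgInf (coeffDissipation ν c)) :
    ε - δ ≤ longTimeAvgInf (coeffResolvedDissipation ν N c) := by
  have h := forcingBand_floor hν hg hS hc hε hD
  refine hsec.trans ?_
  rw [div_le_iff₀ hG]
  linarith [mul_comm (forceSq N g) (longTimeAvgInf (coeffResolvedDissipation ν N c))]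

end R

/-! ## Phase 2L — by-name edges (k = 2 §A3) + the new edge C5 through `Correlation.NoMeanLeakage` -/

/-- **C5. `Correlation.NoMeanLeakage` (stmt-AnomalousDissipation-14265) ⟹ the stub, BY NAME** — through the landed
bridge `resolvedDissipation_of_noMeanLeakage` (NML ⟹ RD) and k = 2's C1 (RD ⟹ stub). -/
theorem stub_of_noMeanLeakage (h : Theses.Correlation.NoMeanLeakage) : Statement.stub_fixedViscosityResolution :=
  stub_of_resolvedDissipation
    (Theorems.MomentParityResolvedDissipation.NoMeanLeakageBridge.resolvedDissipation_of_noMeanLeakage h)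

/-! ## Phase 2T — the trajectory shell and the ONE sub-stub to register -/

section T
variable {ν : ℝ} {N K : ℕ} {g : ℤ³ → ℂ³} {S : Finset ℤ³} {c : ℝ → ↥S → ℂ³}

/-- T2 Pointwise RAMP TAIL SPLIT: with `D = νZ` the dissipation, `P` the palinstrophy sum
`4π²Σ|k|⁴‖c_k‖²`, `tail_M = D − D_M`: `tail_M ≤ 2(D − L)₊ + ν(1 + 2L/ν)² M⁻² · P/(1+Z)²`
(on `{D > 2L}`: `tail ≤ D ≤ 2(D−L)₊`; on `{D ≤ 2L}`: `tail ≤ νP/M²`, `1+Z ≤ 1+2L/ν`). Pure real arithmetic. -/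
theorem ramp_tail_split {D DM P L M ν : ℝ} (hν : 0 < ν) (hM : 0 < M) (hL : 0 ≤ L) (hDM0 : 0 ≤ DM)
    (hDMD : DM ≤ D) (hP : 0 ≤ P) (htail : D - DM ≤ ν * P / M ^ 2) :
    D - DM ≤ 2 * max (D - L) 0 + ν * (1 + 2 * L / ν) ^ 2 / M ^ 2 * (P / (1 + D / ν) ^ 2) := by
  sorry

/-- T3 `liminf` ARITHMETIC for running means: `D_M = D − tail`, all locally integrable with bounded means:
`⟨D⟩⁻ − ⟨tail⟩⁺ ≤ ⟨D_M⟩⁻` (`timeMean_add`, `Filter.le_liminf_add`-type bookkeeping). -/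
theorem longTimeAvgInf_sub_le {f r h : ℝ → ℝ} (hf : ∀ t, f t = r t + h t)
    (hri : ∀ T, 0 < T → IntervalIntegrable r volume 0 T) (hhi : ∀ T, 0 < T → IntervalIntegrable h volume 0 T)
    (hr : IsBoundedUnder (· ≥ ·) atTop (timeMean r)) (hr' : IsBoundedUnder (· ≤ ·) atTop (timeMean r))
    (hh : IsBoundedUnder (· ≥ ·) atTop (timeMean h)) (hh' : IsBoundedUnder (· ≤ ·) atTop (timeMean h)) :
    longTimeAvgInf f - longTimeAvgSup h ≤ longTimeAvgInf r := by
  sorry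

/-- T1 **Long-time pathwise Foias–Guillopé–Temam**, `K`-uniform: `⟨P/(1+Z)²⟩⁺ ≤ C(ν, N, g)` along every
trajectory (window lemma `fgt_integral_bound` is affine in the window; enstrophy derivative
`hasDerivWithinAt_enstrophy` + `galerkin_generator_enstrophy_le`; `⟨Z⟩⁺ ≤ G·R_abs/ν` from P0.5/P0.4). -/
theorem longTimeAvgSup_fgt_le (hν : 0 < ν) (hg : IsDesignerForce N g) :
    ∃ C : ℝ, 0 ≤ C ∧ ∀ (K : ℕ) (S : Finset ℤ³), S = (freqBall K).erase 0 → ∀ c : ℝ → ↥S → ℂ³,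
      IsCoeffTrajectory S ν g c →
      longTimeAvgSup (fun t =>
        (4 * Real.pi ^ 2 * ∑ k : ↥S, freqNormSq (k : ℤ³) ^ 2 * ‖c t k‖ ^ 2) /
          (1 + 4 * Real.pi ^ 2 * ∑ k : ↥S, freqNormSq (k : ℤ³) * ‖c t k‖ ^ 2) ^ 2) ≤ C := by
  sorry

/-- **T4 — THE SUB-STUB TO REGISTER (`stub_uniformEnstrophyIntegrability`; XL, OPEN — the whole open content of
`stub_fixedViscosityResolution`).** `K`-uniform uniform integrability IN TIME of the dissipation along loud
bounded trajectories at fixed `ν`, in ramp form: for every `η > 0` ONE level `L` with `⟨(D − L)₊⟩⁺ ≤ η` for every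
truncation and every admissible trajectory.  Continuous functional ⇒ transfers verbatim to/from ensemble UI of
admissible Galerkin-invariant laws by Krylov–Bogoliubov (k = 2 §A2); ⟸ `MomentParity.ResolvedDissipation`
(`uniformIntegrability_of_resolvedDissipation` + §A2); ⟸ trajectory UI at `(f_g, ν, R_abs)` (k = 2 B4). -/
theorem stub_uniformEnstrophyIntegrability :
    ∀ ν : ℝ, 0 < ν → ∀ (N : ℕ) (g : ℤ³ → ℂ³), IsDesignerForce N g → ∀ (E ε η : ℝ), 0 < η →
      ∃ L : ℝ, 0 ≤ L ∧ ∀ (K : ℕ) (S : Finset ℤ³), S = (freqBall K).erase 0 →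
        ∀ c : ℝ → ↥S → ℂ³, IsCoeffTrajectory S ν g c →
          longTimeAvgSup (coeffEnergy c) ≤ E → ε ≤ longTimeAvgInf (coeffDissipation ν c) →
            longTimeAvgSup (fun t => max (coeffDissipation ν c t - L) 0) ≤ η := by
  sorry

/-- Statement of the sub-stub, by name. -/
def Statement.stub_uniformEnstrophyIntegrability : Prop :=
  type_of% _root_.Summit.AnomalousDissipation.AnomalousDissipation.Cruxes.GalerkinFloor.StubPlan.stub_uniformEnstrophyIntegrability

/-- **T5 — THE SHELL (assembly of Phase 2T): sub-stub ⟹ registered stub**, BY NAME.  Given `δ`: `L` from T4 at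
`η := δ/4`, `C` from T1, `M` with `ν(1+2L/ν)²C/M² ≤ δ/2`; T2 pointwise, time means, T3. -/
theorem stub_of_uniformEnstrophyIntegrability (hUI : Statement.stub_uniformEnstrophyIntegrability) :
    Statement.stub_fixedViscosityResolution := by
  sorry

end T

end Summit.AnomalousDissipation.AnomalousDissipation.Cruxes.GalerkinFloor.StubPlan

end
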